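import Summits.RiemannHypothesis.RiemannHypothesis.Theorems.NymanBeurlingNbThesis
import Summits.RiemannHypothesis.RiemannHypothesis.Theorems.Splittings.NbPlateauLockComplex
import Summits.RiemannHypothesis.RiemannHypothesis.Theorems.Splittings.NbSparsity
import Literature.NumberTheory.LFunctions.NymanBeurlingProofs
import HarnessLib

/-!
# Height windows of the Báez-Duarte distance (NB-NEG, census axis V41 «t-WINDOWS») — cell `rh-split`;
# raw quantified forms, ZERO defs; typed by rh-split-nb-neg g16

Family nb (Nyman–Beurling / Báez-Duarte), lens NEG, card
`run/shared/lean/pub/rh-split/cards/SPLIT-nb-neg.md` §22 (gen 16).  `E_NB = Theses.NymanBeurling.NbThesis`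
(`∀ ε > 0, ∃ N a, I(N,a) < ε`, `I(N,a) = ∫⁻ ‖1 - ζ(1/2+it)·Σ_{k<N} a_k (k+1)^{-(1/2+it)}‖² dt/(1/4+t²)`),
kernel `Theorems.nbThesis_iff_riemannHypothesis`.  The WINDOWED distance restricts the `t`-integral to a
set `E ⊆ ℝ`: `W(E) : ∀ ε > 0, ∃ N a, ∫⁻_{t ∈ E} ‖1 - ζ(1/2+it)·A_a(1/2+it)‖² dt/(1/4+t²) < ε`.

* §W.1 (bookkeeping, kernel).  `W(univ) ↔ NbThesis ↔ RH` (`nbWindow_univ_iff`, `nbWindow_univ_iff_rh`);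
  `W` is antitone in the window (`nbWindow_mono`); `RH → W(E)` for every `E` (`nbWindow_of_rh`).
* §W.2 (the LOW WINDOW IS A THEOREM, RH-free, zero-free, numerics-free).  For every base `b ≥ 2` and every
  height `T ≥ 0` with `T·log b < π/2`, the distance restricted to `|t| ≤ T` tends to `0` along Dirichlet
  polynomials supported on the powers of `b` ALONE (`nbWindow_Icc`; `nbWindow_Icc_two`: `b = 2`, `T = 2`).
  Mechanism (`exists_polynomial_near`): on `[-T,T]` the character `t ↦ b^{-it}` ranges in an arc of
  half-angle `T log b < π/2`, where `1/z = z̄` is a uniform limit of polynomials in `z`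
  (`‖z̄ - cos θ₀·Σ_{j<n}(1 - cos θ₀·z)^j‖ = ‖1 - cos θ₀·z‖^n ≤ (sin θ₀)^n`, `norm_conj_sub_geom`,
  `norm_one_sub_cos_mul_exp_le`), so the (non-self-adjoint) polynomial algebra in `b^{-it}` has the same
  closure as the star algebra, which is all of `C([-T,T], ℂ)` by Stone–Weierstrass; the target is the
  Tikhonov regularisation `ζ̄/(|ζ|²+η)` of `1/ζ` (`window_tikhonov`, dominated convergence off the null set
  of ordinates of zeros, `Literature…ae_riemannZeta_half_ne_zero`).  CONTRAST (kernel, zero-free): on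
  the FULL line the distance along supports `{2^j}` is bounded below (`nb_fullLine_powersOfTwo_floor`, from
  the landed Möbius lock `NbPlateauLock.nbMoebiusLockFree` and the sparsity floor `NbSparsity.nbSparse_floor`).
* §W.3 (polarisation, logic).  Since the low conjunct is a theorem and `RH → B` for every window conjunct
  `B`, a height splitting `W([-T,T]) ∧ B ⟹ RH` holds iff `B ↔ RH` (`nbWindow_split_iff`,
  `nbWindow_split_compl_iff`): the low window is DECORATION, the complement window is summit-strength or
  the scheme is not a splitting.  (The unconditional status of `W({|t| > T})` alone is not decided here.)

Every statement spells `_root_.RiemannHypothesis`.  No definitions.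

HONEST LABEL: «SPLITTING SEARCH over kernel-typed RH-EQUIVALENCES; a splitting A ∧ B ⟹ RH is CONDITIONAL
bookkeeping unless A and B are both proved; nothing here bears on the truth of RH.»
-/

noncomputable section

-- D-0017: `Summit.<S>.<S>.…` is the designed namespace of a single-problem summit.
set_option linter.dupNamespace false

open Complex MeasureTheory Set Filter Topology
open scoped Real ENNReal Polynomial

namespace Summit.RiemannHypothesis.RiemannHypothesis.Theorems.Splittings.NbWindows

open Summit.RiemannHypothesis.RiemannHypothesis.Theses.NymanBeurling
open Summit.RiemannHypothesis.RiemannHypothesis.Theorems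
open Literature.NumberTheory.LFunctions.BaezDuarteOnlyIf

/-! ## §W.0 — two elementary estimates on the unit circle -/

/-- Geometric-series identity on the unit circle: for `‖w‖ = 1`,
`‖w̄ - c·Σ_{j<n} (1 - c w)^j‖ = ‖1 - c w‖^n` (because `w · c·Σ_{j<n}(1-cw)^j = 1 - (1-cw)^n` and `w̄ w = 1`).
[folklore] -/
theorem norm_conj_sub_geom (w c : ℂ) (n : ℕ) (hw : ‖w‖ = 1) :
    ‖(starRingEnd ℂ) w - c * ∑ j ∈ Finset.range n, (1 - c * w) ^ j‖ = ‖1 - c * w‖ ^ n := by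
  have h1 : (starRingEnd ℂ) w * w = 1 := by
    rw [mul_comm, Complex.mul_conj, Complex.normSq_eq_norm_sq, hw]; norm_num
  have h3 := geom_sum_mul (1 - c * w) n
  have h4 : (starRingEnd ℂ) w - c * ∑ j ∈ Finset.range n, (1 - c * w) ^ j =
      (starRingEnd ℂ) w * (1 - w * (c * ∑ j ∈ Finset.range n, (1 - c * w) ^ j)) := by
    rw [mul_sub, mul_one, ← mul_assoc ((starRingEnd ℂ) w) w, h1, one_mul]
  have h2 : (starRingEnd ℂ) w - c * ∑ j ∈ Finset.range n, (1 - c * w) ^ j =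
      (starRingEnd ℂ) w * (1 - c * w) ^ n := by
    rw [h4]
    congr 1
    linear_combination h3
  rw [h2, norm_mul, norm_pow, Complex.norm_conj, hw, one_mul]

/-- Arc estimate: if `|α| ≤ θ₀ < π/2` then `‖1 - cos θ₀ · e^{iα}‖ ≤ sin θ₀`
(`‖1 - cos θ₀ e^{iα}‖² = 1 - 2 cos θ₀ cos α + cos² θ₀ ≤ 1 - cos² θ₀`). [folklore] -/
theorem norm_one_sub_cos_mul_exp_le (α θ₀ : ℝ) (hα : |α| ≤ θ₀) (hθ : θ₀ < π / 2) :
    ‖1 - (Real.cos θ₀ : ℂ) * Complex.exp ((α : ℂ) * I)‖ ≤ Real.sin θ₀ := by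
  have hθ0 : 0 ≤ θ₀ := (abs_nonneg α).trans hα
  have hcos : Real.cos θ₀ ≤ Real.cos α := by
    rw [← Real.cos_abs α]
    exact Real.cos_le_cos_of_nonneg_of_le_pi (abs_nonneg α) (by linarith [Real.pi_pos]) hα
  have hc : 0 < Real.cos θ₀ := Real.cos_pos_of_mem_Ioo ⟨by linarith [Real.pi_pos], hθ⟩
  have hs : 0 ≤ Real.sin θ₀ := Real.sin_nonneg_of_nonneg_of_le_pi hθ0 (by linarith [Real.pi_pos])
  have h5 : Real.cos θ₀ ^ 2 * (Real.sin α ^ 2 + Real.cos α ^ 2) = Real.cos θ₀ ^ 2 := by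
    rw [Real.sin_sq_add_cos_sq, mul_one]
  have hsq : ‖1 - (Real.cos θ₀ : ℂ) * Complex.exp ((α : ℂ) * I)‖ ^ 2 ≤ Real.sin θ₀ ^ 2 := by
    rw [Complex.sq_norm, Complex.normSq_apply]
    simp only [Complex.sub_re, Complex.one_re, Complex.mul_re, Complex.ofReal_re, Complex.ofReal_im,
      Complex.exp_ofReal_mul_I_re, Complex.exp_ofReal_mul_I_im, Complex.sub_im, Complex.one_im,
      Complex.mul_im, zero_mul, sub_zero, add_zero, zero_sub]
    nlinarith [h5, Real.sin_sq_add_cos_sq θ₀, mul_le_mul_of_nonneg_left hcos hc.le]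
  exact (sq_le_sq₀ (norm_nonneg _) hs).1 hsq

/-! ## §W.2a — polynomials in `b^{-it}` are dense in `C([-T,T], ℂ)` when `T log b < π/2` -/

/-- DENSITY OF ONE-SIDED CHARACTERS ON A SHORT WINDOW.  Let `0 < L`, `0 ≤ T`, `L·T < π/2`.  Then every
continuous `U : [-T,T] → ℂ` is, within any `δ > 0` uniformly, a polynomial in the single character
`t ↦ e^{-iLt}` (no conjugates needed): `e^{iLt} = conj e^{-iLt}` lies in the closed algebra generated by
`e^{-iLt}` (geometric series of `norm_conj_sub_geom` / `norm_one_sub_cos_mul_exp_le`), so that algebra has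
the closure of the star algebra, which is everything by Stone–Weierstrass
(Mathlib `ContinuousMap.starSubalgebra_topologicalClosure_eq_top_of_separatesPoints`; the character
separates points since `sin` is injective on `[-π/2, π/2]`). [folklore] -/
theorem exists_polynomial_near {L T : ℝ} (hL : 0 < L) (hT : 0 ≤ T) (hLT : L * T < π / 2)
    (U : C(Set.Icc (-T) T, ℂ)) {δ : ℝ} (hδ : 0 < δ) :
    ∃ p : ℂ[X], ∀ x : Set.Icc (-T) T,
      ‖U x - p.eval (Complex.exp (((-(L * x) : ℝ) : ℂ) * I))‖ < δ := by
  classical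
  set Z : C(Set.Icc (-T) T, ℂ) := ⟨fun x => Complex.exp (((-(L * x) : ℝ) : ℂ) * I), by fun_prop⟩ with hZdef
  have hZ : ∀ x : Set.Icc (-T) T, Z x = Complex.exp (((-(L * x) : ℝ) : ℂ) * I) := fun x => rfl
  set θ₀ : ℝ := L * T with hθ₀
  have hθ₀0 : 0 ≤ θ₀ := mul_nonneg hL.le hT
  have hc : 0 < Real.cos θ₀ := Real.cos_pos_of_mem_Ioo ⟨by linarith [Real.pi_pos], hLT⟩
  have hs0 : 0 ≤ Real.sin θ₀ := Real.sin_nonneg_of_nonneg_of_le_pi hθ₀0 (by linarith [Real.pi_pos])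
  have hs1 : Real.sin θ₀ < 1 := by nlinarith [Real.sin_sq_add_cos_sq θ₀]
  have habs : ∀ x : Set.Icc (-T) T, |(-(L * x) : ℝ)| ≤ θ₀ := by
    intro x
    rw [abs_neg, abs_mul, abs_of_pos hL]
    exact mul_le_mul_of_nonneg_left (abs_le.2 ⟨x.2.1, x.2.2⟩) hL.le
  have hnormZ : ∀ x : Set.Icc (-T) T, ‖Z x‖ = 1 := fun x => by rw [hZ]; exact Complex.norm_exp_ofReal_mul_I _
  -- the closed polynomial algebra generated by `Z`
  set A : Subalgebra ℂ C(Set.Icc (-T) T, ℂ) := (Algebra.adjoin ℂ {Z}).topologicalClosure with hA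
  -- key step: `star Z ∈ A`
  have hq : ∀ n : ℕ, (Real.cos θ₀ : ℂ) • ∑ j ∈ Finset.range n, (1 - (Real.cos θ₀ : ℂ) • Z) ^ j ∈
      Algebra.adjoin ℂ {Z} := by
    intro n
    refine Subalgebra.smul_mem _ (sum_mem fun j _ => pow_mem ?_ _) _
    exact sub_mem (one_mem _) (Subalgebra.smul_mem _ (Algebra.self_mem_adjoin_singleton ℂ Z) _)
  have hstar : star Z ∈ A := by
    rw [← SetLike.mem_coe, hA, Subalgebra.topologicalClosure_coe, Metric.mem_closure_iff]
    intro ε hε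
    obtain ⟨n, hn⟩ := exists_pow_lt_of_lt_one hε hs1
    refine ⟨_, hq n, ?_⟩
    rw [dist_eq_norm]
    refine lt_of_le_of_lt ?_ hn
    rw [ContinuousMap.norm_le _ (pow_nonneg hs0 n)]
    intro x
    simp only [ContinuousMap.sub_apply, ContinuousMap.star_apply, ContinuousMap.smul_apply,
      ContinuousMap.sum_apply, ContinuousMap.pow_apply, ContinuousMap.one_apply, smul_eq_mul,
      Complex.star_def]
    rw [norm_conj_sub_geom _ _ _ (hnormZ x), hZ]
    exact pow_le_pow_left₀ (norm_nonneg _) (norm_one_sub_cos_mul_exp_le _ _ (habs x) hLT) n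
  -- `Z` separates points
  have hinj : Function.Injective Z := by
    intro x y hxy
    have h1 : Real.sin (-(L * x)) = Real.sin (-(L * y)) := by
      have := congrArg Complex.im hxy
      rwa [hZ, hZ, Complex.exp_ofReal_mul_I_im, Complex.exp_ofReal_mul_I_im] at this
    have hx' : (-(L * x) : ℝ) ∈ Set.Icc (-(π / 2)) (π / 2) := by
      have := abs_le.1 (habs x); constructor <;> linarith
    have hy' : (-(L * y) : ℝ) ∈ Set.Icc (-(π / 2)) (π / 2) := by
      have := abs_le.1 (habs y); constructor <;> linarith
    have h2 := Real.injOn_sin hx' hy' h1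
    exact Subtype.ext (mul_left_cancel₀ hL.ne' (neg_injective h2))
  have hsep : (StarAlgebra.adjoin ℂ {Z}).SeparatesPoints := by
    intro x y hxy
    exact ⟨Z, ⟨Z, StarAlgebra.self_mem_adjoin_singleton ℂ Z, rfl⟩, fun h => hxy (hinj h)⟩
  have hS : (StarAlgebra.adjoin ℂ {Z}).topologicalClosure = ⊤ :=
    ContinuousMap.starSubalgebra_topologicalClosure_eq_top_of_separatesPoints _ hsep
  -- the star algebra sits inside `A`, hence so does its closure
  have hSA : ((StarAlgebra.adjoin ℂ {Z} : StarSubalgebra ℂ C(Set.Icc (-T) T, ℂ)) : Set C(Set.Icc (-T) T, ℂ)) ⊆ (A : Set C(Set.Icc (-T) T, ℂ)) := by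
    intro f hf
    have hf' : f ∈ Algebra.adjoin ℂ ({Z} ∪ star {Z}) := by
      rw [← StarAlgebra.adjoin_toSubalgebra]; exact hf
    refine (Algebra.adjoin_le ?_ : Algebra.adjoin ℂ ({Z} ∪ star {Z}) ≤ A) hf'
    rintro g (hg | hg)
    · rw [Set.mem_singleton_iff] at hg
      rw [hg]
      exact Subalgebra.le_topologicalClosure _ (Algebra.self_mem_adjoin_singleton ℂ Z)
    · rw [Set.mem_star, Set.mem_singleton_iff] at hg
      rw [← star_star g, hg]
      exact hstar
  have hAuniv : (A : Set C(Set.Icc (-T) T, ℂ)) = Set.univ := by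
    apply Set.eq_univ_of_univ_subset
    have h1 : (((StarAlgebra.adjoin ℂ {Z}).topologicalClosure : StarSubalgebra ℂ C(Set.Icc (-T) T, ℂ)) :
        Set C(Set.Icc (-T) T, ℂ)) = Set.univ := by
      rw [hS]; exact StarSubalgebra.coe_top
    rw [← h1, StarSubalgebra.topologicalClosure_coe]
    exact closure_minimal hSA (Subalgebra.isClosed_topologicalClosure _)
  -- conclude
  have hU : U ∈ (A : Set C(Set.Icc (-T) T, ℂ)) := by rw [hAuniv]; exact Set.mem_univ _
  rw [hA, Subalgebra.topologicalClosure_coe, Metric.mem_closure_iff] at hU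
  obtain ⟨f, hf, hUf⟩ := hU δ hδ
  rw [SetLike.mem_coe, Algebra.adjoin_singleton_eq_range_aeval, AlgHom.mem_range] at hf
  obtain ⟨p, rfl⟩ := hf
  refine ⟨p, fun x => ?_⟩
  have h1 : ‖(U - Polynomial.aeval Z p) x‖ ≤ ‖U - Polynomial.aeval Z p‖ :=
    ContinuousMap.norm_coe_le_norm _ x
  rw [dist_eq_norm] at hUf
  have h2 : (U - Polynomial.aeval Z p) x = U x - p.eval (Complex.exp (((-(L * x) : ℝ) : ℂ) * I)) := by
    rw [ContinuousMap.sub_apply, Polynomial.aeval_continuousMap_apply, hZ]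
  rw [h2] at h1
  exact h1.trans_lt hUf

/-! ## §W.2b — the Tikhonov target: the measure-theoretic half -/

/-- TIKHONOV STEP.  Let `G : ℝ → ℂ` be continuous with Lebesgue-null zero set and `T` real.  For every
`ε > 0` there are `δ > 0` and a continuous `U : ℝ → ℂ` (namely `U = Ḡ/(|G|²+η)`, for which
`|1 - G U| = η/(|G|²+η) → 0` a.e. as `η → 0`, dominated by `1`) such that every function `P` with
`|U - P| ≤ δ` on `[-T,T]` has `∫⁻_{[-T,T]} |1 - G P|²/(1/4+t²) < ε`. [folklore] -/
theorem window_tikhonov {G : ℝ → ℂ} (hG : Continuous G) (hG0 : ∀ᵐ t : ℝ, G t ≠ 0) (T : ℝ)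
    {ε : ℝ} (hε : 0 < ε) :
    ∃ δ : ℝ, 0 < δ ∧ ∃ U : ℝ → ℂ, Continuous U ∧ ∀ P : ℝ → ℂ,
      (∀ t ∈ Set.Icc (-T) T, ‖U t - P t‖ ≤ δ) →
        ∫⁻ t in Set.Icc (-T) T, ENNReal.ofReal (‖1 - G t * P t‖ ^ 2 / (1 / 4 + t ^ 2)) <
          ENNReal.ofReal ε := by
  set K : Set ℝ := Set.Icc (-T) T with hKdef
  have hKfin : volume K ≠ ⊤ := by rw [hKdef, Real.volume_Icc]; exact ENNReal.ofReal_ne_top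
  have hvol : volume K ≤ ENNReal.ofReal (2 * |T|) := by
    rw [hKdef, Real.volume_Icc]
    exact ENNReal.ofReal_le_ofReal (by linarith [le_abs_self T])
  -- the regularisation parameters `η_m = 1/(m+1)`
  set η : ℕ → ℝ := fun m => 1 / ((m : ℝ) + 1) with hηdef
  have hη0 : ∀ m, 0 < η m := fun m => by rw [hηdef]; positivity
  have hηlim : Tendsto η atTop (𝓝 0) := tendsto_one_div_add_atTop_nhds_zero_nat
  set F : ℕ → ℝ → ℝ≥0∞ := fun m t =>
    ENNReal.ofReal ((η m / (‖G t‖ ^ 2 + η m)) ^ 2 / (1 / 4 + t ^ 2)) with hFdef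
  have hGm : Measurable G := hG.measurable
  have hFm : ∀ m, Measurable (F m) := by
    intro m
    refine Measurable.ennreal_ofReal ?_
    exact ((measurable_const.div ((hGm.norm.pow_const 2).add_const _)).pow_const 2).div
      (measurable_const.add (measurable_id.pow_const 2))
  have hF4 : ∀ m t, (η m / (‖G t‖ ^ 2 + η m)) ^ 2 / (1 / 4 + t ^ 2) ≤ 4 := by
    intro m t
    have hηm := hη0 m
    have hq1 : η m / (‖G t‖ ^ 2 + η m) ≤ 1 := by
      rw [div_le_one (by positivity)]; nlinarith [norm_nonneg (G t)]
    have hq0 : 0 ≤ η m / (‖G t‖ ^ 2 + η m) := by positivity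
    have hq2 : (η m / (‖G t‖ ^ 2 + η m)) ^ 2 ≤ 1 := pow_le_one₀ hq0 hq1
    rw [div_le_iff₀ (by positivity)]
    nlinarith [sq_nonneg t]
  -- dominated convergence: `∫⁻_K F m → 0`
  have hlim : Tendsto (fun m => ∫⁻ t in K, F m t) atTop (𝓝 0) := by
    have h := tendsto_lintegral_of_dominated_convergence (μ := volume.restrict K)
      (F := F) (f := fun _ => 0) (fun _ => ENNReal.ofReal 4) hFm ?_ ?_ ?_
    · simpa only [lintegral_zero] using h
    · exact fun m => ae_of_all _ fun t => ENNReal.ofReal_le_ofReal (hF4 m t)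
    · show ∫⁻ _ in K, ENNReal.ofReal 4 ≠ ⊤
      rw [setLIntegral_const]; exact ENNReal.mul_ne_top ENNReal.ofReal_ne_top hKfin
    · filter_upwards [ae_restrict_of_ae (s := K) hG0] with t ht
      have hGt : 0 < ‖G t‖ := norm_pos_iff.2 ht
      have h0 : (‖G t‖ ^ 2 + 0 : ℝ) ≠ 0 := by positivity
      have h1 : Tendsto (fun m : ℕ => (η m / (‖G t‖ ^ 2 + η m)) ^ 2 / (1 / 4 + t ^ 2)) atTop
          (𝓝 ((0 / (‖G t‖ ^ 2 + 0)) ^ 2 / (1 / 4 + t ^ 2))) :=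
        ((hηlim.div (tendsto_const_nhds.add hηlim) h0).pow 2).div_const _
      rw [zero_div, zero_pow two_ne_zero, zero_div] at h1
      simpa only [ENNReal.ofReal_zero] using ENNReal.tendsto_ofReal h1
  have hε4 : (0 : ℝ≥0∞) < ENNReal.ofReal (ε / 4) := ENNReal.ofReal_pos.2 (by positivity)
  obtain ⟨m, hm⟩ := (hlim.eventually (gt_mem_nhds hε4)).exists
  -- the Tikhonov function `U = Ḡ/(|G|²+η)`
  have hηm := hη0 m
  set U : ℝ → ℂ := fun t => (starRingEnd ℂ) (G t) / ((‖G t‖ ^ 2 + η m : ℝ) : ℂ) with hUdef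
  have hden : ∀ t, ((‖G t‖ ^ 2 + η m : ℝ) : ℂ) ≠ 0 := fun t =>
    Complex.ofReal_ne_zero.2 (by positivity)
  have hUc : Continuous U :=
    (Complex.continuous_conj.comp hG).div
      (Complex.continuous_ofReal.comp ((hG.norm.pow 2).add continuous_const)) hden
  have hGU : ∀ t, 1 - G t * U t = ((η m / (‖G t‖ ^ 2 + η m) : ℝ) : ℂ) := by
    intro t
    have hd : (‖G t‖ ^ 2 + η m : ℝ) ≠ 0 := by positivity
    have hd' : ((‖G t‖ : ℂ) ^ 2 + (η m : ℂ)) ≠ 0 := by exact_mod_cast hd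
    rw [hUdef]
    dsimp only
    rw [mul_div_assoc', Complex.mul_conj, Complex.normSq_eq_norm_sq]
    push_cast
    field_simp
    ring
  have hnGU : ∀ t, ‖1 - G t * U t‖ = η m / (‖G t‖ ^ 2 + η m) := by
    intro t
    rw [hGU, Complex.norm_real, Real.norm_of_nonneg (by positivity)]
  -- a sup bound for `G` on `K` and the choice of `δ`
  obtain ⟨M, hM⟩ := isCompact_Icc.exists_bound_of_continuousOn (hG.continuousOn (s := K))
  set M' : ℝ := max M 1 with hM'
  have hM'1 : 1 ≤ M' := le_max_right _ _
  have hGM : ∀ t ∈ K, ‖G t‖ ≤ M' := fun t ht => (hM t ht).trans (le_max_left _ _)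
  set C : ℝ := 16 * M' ^ 2 * |T| + 1 with hC
  have hCpos : 0 < C := by positivity
  set δ : ℝ := min 1 (ε / (4 * C)) with hδdef
  have hδpos : 0 < δ := lt_min one_pos (by positivity)
  have hδ1 : δ ≤ 1 := min_le_left _ _
  have hδC : δ ≤ ε / (4 * C) := min_le_right _ _
  refine ⟨δ, hδpos, U, hUc, fun P hP => ?_⟩
  -- pointwise bound on the window
  have hpt : ∀ t ∈ K, ENNReal.ofReal (‖1 - G t * P t‖ ^ 2 / (1 / 4 + t ^ 2)) ≤
      2 * F m t + ENNReal.ofReal (8 * M' ^ 2 * δ ^ 2) := by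
    intro t ht
    have hw : (0 : ℝ) < 1 / 4 + t ^ 2 := by positivity
    have hq0 : 0 ≤ η m / (‖G t‖ ^ 2 + η m) := by positivity
    have h1 : ‖1 - G t * P t‖ ≤ η m / (‖G t‖ ^ 2 + η m) + M' * δ := by
      have e : 1 - G t * P t = (1 - G t * U t) + G t * (U t - P t) := by ring
      rw [e]
      refine (norm_add_le _ _).trans ?_
      rw [hnGU t, norm_mul]
      exact add_le_add le_rfl (mul_le_mul (hGM t ht) (hP t ht) (norm_nonneg _) (by positivity))
    have h1' := mul_le_mul h1 h1 (norm_nonneg _) (by positivity)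
    have h3 : ‖1 - G t * P t‖ ^ 2 ≤ 2 * (η m / (‖G t‖ ^ 2 + η m)) ^ 2 + 2 * (M' * δ) ^ 2 := by
      nlinarith [sq_nonneg (η m / (‖G t‖ ^ 2 + η m) - M' * δ)]
    have h4 : 2 * (M' * δ) ^ 2 / (1 / 4 + t ^ 2) ≤ 8 * M' ^ 2 * δ ^ 2 := by
      rw [div_le_iff₀ hw]; nlinarith [sq_nonneg t, sq_nonneg (M' * δ)]
    have h2 : ‖1 - G t * P t‖ ^ 2 / (1 / 4 + t ^ 2) ≤
        2 * ((η m / (‖G t‖ ^ 2 + η m)) ^ 2 / (1 / 4 + t ^ 2)) + 8 * M' ^ 2 * δ ^ 2 := by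
      calc ‖1 - G t * P t‖ ^ 2 / (1 / 4 + t ^ 2)
          ≤ (2 * (η m / (‖G t‖ ^ 2 + η m)) ^ 2 + 2 * (M' * δ) ^ 2) / (1 / 4 + t ^ 2) :=
            div_le_div_of_nonneg_right h3 hw.le
        _ = 2 * ((η m / (‖G t‖ ^ 2 + η m)) ^ 2 / (1 / 4 + t ^ 2)) +
              2 * (M' * δ) ^ 2 / (1 / 4 + t ^ 2) := by ring
        _ ≤ _ := by linarith [h4]
    calc ENNReal.ofReal (‖1 - G t * P t‖ ^ 2 / (1 / 4 + t ^ 2))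
        ≤ ENNReal.ofReal (2 * ((η m / (‖G t‖ ^ 2 + η m)) ^ 2 / (1 / 4 + t ^ 2)) + 8 * M' ^ 2 * δ ^ 2) :=
          ENNReal.ofReal_le_ofReal h2
      _ = 2 * F m t + ENNReal.ofReal (8 * M' ^ 2 * δ ^ 2) := by
          rw [ENNReal.ofReal_add (by positivity) (by positivity),
            ENNReal.ofReal_mul (by norm_num : (0 : ℝ) ≤ 2), ENNReal.ofReal_ofNat]
  have hI1 : ∫⁻ t in K, (2 * F m t + ENNReal.ofReal (8 * M' ^ 2 * δ ^ 2)) =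
      2 * (∫⁻ t in K, F m t) + ENNReal.ofReal (8 * M' ^ 2 * δ ^ 2) * volume K := by
    rw [lintegral_add_right _ measurable_const, lintegral_const_mul _ (hFm m), setLIntegral_const]
  have hkey : 2 * (ε / 4) + 8 * M' ^ 2 * δ ^ 2 * (2 * |T|) < ε := by
    have hδ2 : δ ^ 2 ≤ δ := by nlinarith
    have h1 : 16 * M' ^ 2 * |T| * δ ^ 2 ≤ ε / 4 := by
      calc 16 * M' ^ 2 * |T| * δ ^ 2 ≤ C * δ ^ 2 := by gcongr; linarith
        _ ≤ C * δ := by gcongr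
        _ ≤ C * (ε / (4 * C)) := by gcongr
        _ = ε / 4 := by field_simp
    nlinarith [abs_nonneg T]
  calc ∫⁻ t in K, ENNReal.ofReal (‖1 - G t * P t‖ ^ 2 / (1 / 4 + t ^ 2))
      ≤ ∫⁻ t in K, (2 * F m t + ENNReal.ofReal (8 * M' ^ 2 * δ ^ 2)) :=
        setLIntegral_mono' measurableSet_Icc hpt
    _ = 2 * (∫⁻ t in K, F m t) + ENNReal.ofReal (8 * M' ^ 2 * δ ^ 2) * volume K := hI1
    _ ≤ 2 * ENNReal.ofReal (ε / 4) + ENNReal.ofReal (8 * M' ^ 2 * δ ^ 2) * ENNReal.ofReal (2 * |T|) :=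
        add_le_add (mul_le_mul' le_rfl hm.le) (mul_le_mul' le_rfl hvol)
    _ = ENNReal.ofReal (2 * (ε / 4) + 8 * M' ^ 2 * δ ^ 2 * (2 * |T|)) := by
        rw [← ENNReal.ofReal_ofNat 2, ← ENNReal.ofReal_mul (by norm_num : (0 : ℝ) ≤ 2),
          ← ENNReal.ofReal_mul (by positivity : (0 : ℝ) ≤ 8 * M' ^ 2 * δ ^ 2),
          ← ENNReal.ofReal_add (by positivity : (0 : ℝ) ≤ 2 * (ε / 4))
            (by positivity : (0 : ℝ) ≤ 8 * M' ^ 2 * δ ^ 2 * (2 * |T|))]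
    _ < ENNReal.ofReal ε := (ENNReal.ofReal_lt_ofReal_iff hε).2 hkey


end Summit.RiemannHypothesis.RiemannHypothesis.Theorems.Splittings.NbWindows

end
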